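import Mathlib
import Summits.NavierStokesRegularity.NavierStokesRegularity.Theorems.EulerZoomLiouvillePowerGaugeEulerLiouvilleSelfSimilarSwirlFatTail
import Summits.NavierStokesRegularity.NavierStokesRegularity.Theorems.EulerZoomLiouvillePowerGaugeEulerLiouvilleSelfSimilarSwirlRatchetLocal
import HarnessLib

/-!
# Crux E `PowerGaugeEulerLiouville` (stmt-NavierStokesRegularity-19832): PAST TWINS of the remaining swirl-ratchet members — so that the past-exact
# axisymmetric disjunct can take `IsTameSwirl` VERBATIM (width seat ns-ezl-w3 g3)

Route №10 `EulerZoomLiouville` (NavierStokesRegularity), crux E; LEAD ns-typeII-p2 g12.  The skeleton's `IsTameSwirlPast ρ V` (past-exact members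
`u τ = selfSimilarCollapse γ T V τ (· − x₀)` for `τ < T₁`, `T₁ ≤ 0`, `T₁ ≤ T`) lists only the five tame-swirl alternatives that had past twins (no swirl; GLOBAL linear growth
with bounded swirl / finite swirl support / `L^q`-Casimir `q < 3/ρ` / slow inflow).  This file supplies the three missing past twins, each = the profile-level kill already
landed (the profile `(V, P′)` solves CIV (3.3) about the ORIGIN by `Past.exists_isSelfSimilarEulerProfile`) + ezl-w2's past endgame `NeedleRace.selfSimilar_ae_eq_zero_of_axisymNoSwirlC2_past`:

* `SwirlRatchet.selfSimilar_ae_eq_zero_of_axisym_boundedSwirl_C2_local_past` — linear growth ONLY ON THE SWIRL SET + bounded swirl ((L) p644521 `hasNoSwirl_of_bounded_swirl_local`);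
* `SwirlRatchet.selfSimilar_ae_eq_zero_of_axisym_bernoulliBounded_C2_local_past` — linear growth on the swirl set + the Bernoulli function of every classical pressure bounded
  above on the swirl set ((K1)/(L) `hasNoSwirl_of_bernoulli_le_local`);
* `SwirlRatchet.selfSimilar_ae_eq_zero_of_axisym_swirlCasimir_C2_past` — global linear growth + ONE finite swirl Casimir `∫⁻|rV_θ|^q < ∞` with `0 < q`, `q ≠ 3/ρ`
  ((C5) p642450 `hasNoSwirl_of_swirl_Lp_ne`: below the balance the volume law, above it the fat tail).

For the LEAD: with these, `IsTameSwirlPast := IsTameSwirl` (and the `L^q` clause of BOTH may read `q ≠ 3/ρ` instead of `q < 3/ρ`, dispatched to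
`…swirlCasimir_C2[_past]`); the any-axis form follows from `ClassIsometry.pastSelfSimilar_ae_eq_zero_of_conj` (p645185).

WHAT THIS IS NOT: not NS regularity, not the crux E — by-name completions of axisymmetric strata of the crux CLASS 19832 (MODEL lattice; E/NS strata)
`--supports` stmt-19832; 19832 OPEN. [cite: Chae2007CMPEuler, Thm 2.1–2.2 + Note added p. 6; ConstantinIgnatovaVicol2026Putative §3.4.3 (3.30)–(3.31)]
-/

noncomputable section

-- flat `Theorems/<Route><Decl>…` files of one crux share the namespace of the crux (tree convention: `Summit.<S>.<S>.…`)
set_option linter.dupNamespace false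

open MeasureTheory Set Filter Topology Metric Function InnerProductSpace
open scoped RealInnerProductSpace NNReal ENNReal ContDiff

namespace Summit.NavierStokesRegularity.NavierStokesRegularity.Theorems.PowerGaugeEulerLiouville

open Literature.Analysis Literature.Analysis.FluidPDE Literature.Analysis.FunctionSpaces

namespace SwirlRatchet

variable {u : ℝ → EuclideanSpace ℝ (Fin 3) → EuclideanSpace ℝ (Fin 3)} {p : ℝ → EuclideanSpace ℝ (Fin 3) → ℝ}
  {H : ℝ → EuclideanSpace ℝ (Fin 3) → EuclideanSpace ℝ (Fin 3) →L[ℝ] EuclideanSpace ℝ (Fin 3)} {c : ℝ≥0}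
  {V : EuclideanSpace ℝ (Fin 3) → EuclideanSpace ℝ (Fin 3)} {P : EuclideanSpace ℝ (Fin 3) → ℝ}

/-- **PAST TWIN of `selfSimilar_ae_eq_zero_of_axisym_boundedSwirl_C2_local`**: velocity and pressure exactly self-similar about `(T, x₀)` for `τ < T₁` (`T₁ ≤ 0`, `T₁ ≤ T`);
axisymmetric `C²` profile with linear growth ON THE SWIRL SET and bounded swirl ⇒ trivial. [cite: Chae2007CMPEuler, Thm 2.2 + Note added p. 6] -/
theorem selfSimilar_ae_eq_zero_of_axisym_boundedSwirl_C2_local_past {ρ T T₁ : ℝ} (hρ : 0 < ρ) (hρ1 : ρ ≤ 1 / 2)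
    (hT₁ : T₁ ≤ 0) (hTT₁ : T₁ ≤ T) (x₀ : EuclideanSpace ℝ (Fin 3))
    (hsw : IsSuitableWeakSolutionOn (slab (EuclideanSpace ℝ (Fin 3)) (Iio 0) isOpen_Iio) 0 0 u p)
    (hH : HasWeakSpatialGradientOn (slab (EuclideanSpace ℝ (Fin 3)) (Iio 0) isOpen_Iio) u H)
    (hgauge : ∀ a : ℝ, 0 < a →
      ENNReal.ofReal (a ^ (2 * ρ)) * cknA a (0 : ℝ × EuclideanSpace ℝ (Fin 3)) u +
          ENNReal.ofReal (a ^ ρ) * cknE a (0 : ℝ × EuclideanSpace ℝ (Fin 3)) H +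
        ENNReal.ofReal (a ^ (2 * ρ)) * cknD a (0 : ℝ × EuclideanSpace ℝ (Fin 3)) p ≤ (c : ENNReal))
    (hu : ∀ τ : ℝ, τ < T₁ → u τ = fun x => selfSimilarCollapse (1 / (2 + ρ)) T V τ (x - x₀))
    (hp : ∀ τ : ℝ, τ < T₁ → p τ = fun x => selfSimilarCollapsePressure (1 / (2 + ρ)) T P τ (x - x₀))
    (hV : ContDiff ℝ 2 V) (hax : IsAxisymmetric V)
    (hlin : ∃ K₁ : ℝ, ∀ y, swirl V y ≠ 0 → ‖V y‖ ≤ K₁ * (1 + ‖y‖))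
    (hB : ∃ B : ℝ, ∀ y, |swirl V y| ≤ B) :
    uncurry u =ᵐ[volume.restrict (Iio (0 : ℝ) ×ˢ (univ : Set (EuclideanSpace ℝ (Fin 3))))] 0 := by
  obtain ⟨K₁, hK₁⟩ := hlin
  obtain ⟨B, hBB⟩ := hB
  have hγ2 : 1 / (2 + ρ) < 1 / 2 := one_div_lt_one_div_of_lt two_pos (by linarith)
  obtain ⟨P', hprof⟩ := Past.exists_isSelfSimilarEulerProfile hρ hT₁ hTT₁ hsw.distributional hu hp hV
  have hns : HasNoSwirl V := hasNoSwirl_of_bounded_swirl_local hprof hax hγ2 hK₁ hBB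
  exact NeedleRace.selfSimilar_ae_eq_zero_of_axisymNoSwirlC2_past hρ hρ1 hT₁ hTT₁ x₀ hsw hH hgauge hu hp hV hax hns

/-- **PAST TWIN of `selfSimilar_ae_eq_zero_of_axisym_bernoulliBounded_C2_local`**: same window shape; axisymmetric `C²` profile with linear growth on the swirl set and,
for EVERY classical pressure `P′` of the profile (CIV (3.3) about the origin), the Bernoulli function `ℋ_{P′}` bounded above on the swirl set ⇒ trivial.
[cite: ConstantinIgnatovaVicol2026Putative, §3.4.3 eq. (3.30)–(3.31)] -/
theorem selfSimilar_ae_eq_zero_of_axisym_bernoulliBounded_C2_local_past {ρ T T₁ : ℝ} (hρ : 0 < ρ) (hρ1 : ρ ≤ 1 / 2)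
    (hT₁ : T₁ ≤ 0) (hTT₁ : T₁ ≤ T) (x₀ : EuclideanSpace ℝ (Fin 3))
    (hsw : IsSuitableWeakSolutionOn (slab (EuclideanSpace ℝ (Fin 3)) (Iio 0) isOpen_Iio) 0 0 u p)
    (hH : HasWeakSpatialGradientOn (slab (EuclideanSpace ℝ (Fin 3)) (Iio 0) isOpen_Iio) u H)
    (hgauge : ∀ a : ℝ, 0 < a →
      ENNReal.ofReal (a ^ (2 * ρ)) * cknA a (0 : ℝ × EuclideanSpace ℝ (Fin 3)) u +
          ENNReal.ofReal (a ^ ρ) * cknE a (0 : ℝ × EuclideanSpace ℝ (Fin 3)) H +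
        ENNReal.ofReal (a ^ (2 * ρ)) * cknD a (0 : ℝ × EuclideanSpace ℝ (Fin 3)) p ≤ (c : ENNReal))
    (hu : ∀ τ : ℝ, τ < T₁ → u τ = fun x => selfSimilarCollapse (1 / (2 + ρ)) T V τ (x - x₀))
    (hp : ∀ τ : ℝ, τ < T₁ → p τ = fun x => selfSimilarCollapsePressure (1 / (2 + ρ)) T P τ (x - x₀))
    (hV : ContDiff ℝ 2 V) (hax : IsAxisymmetric V)
    (hlin : ∃ K₁ : ℝ, ∀ y, swirl V y ≠ 0 → ‖V y‖ ≤ K₁ * (1 + ‖y‖))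
    (hB : ∀ P' : EuclideanSpace ℝ (Fin 3) → ℝ, IsSelfSimilarEulerProfile (1 / (2 + ρ)) 0 V P' →
      ∃ Mb : ℝ, ∀ y, swirl V y ≠ 0 → selfSimilarBernoulli (1 / (2 + ρ)) 0 V P' y ≤ Mb) :
    uncurry u =ᵐ[volume.restrict (Iio (0 : ℝ) ×ˢ (univ : Set (EuclideanSpace ℝ (Fin 3))))] 0 := by
  obtain ⟨K₁, hK₁⟩ := hlin
  have hγ2 : 1 / (2 + ρ) < 1 / 2 := one_div_lt_one_div_of_lt two_pos (by linarith)
  obtain ⟨P', hprof⟩ := Past.exists_isSelfSimilarEulerProfile hρ hT₁ hTT₁ hsw.distributional hu hp hV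
  obtain ⟨Mb, hMb⟩ := hB P' hprof
  have hns : HasNoSwirl V := hasNoSwirl_of_bernoulli_le_local hprof hax hγ2 hK₁ hMb
  exact NeedleRace.selfSimilar_ae_eq_zero_of_axisymNoSwirlC2_past hρ hρ1 hT₁ hTT₁ x₀ hsw hH hgauge hu hp hV hax hns

/-- **PAST TWIN of `selfSimilar_ae_eq_zero_of_axisym_swirlCasimir_C2`**: same window shape; axisymmetric `C²` profile of linear growth with ONE finite swirl Casimir
`∫⁻ ofReal(|swirl V|^q) < ⊤`, `0 < q`, `q ≠ 3/ρ` ⇒ trivial. [cite: Chae2007CMPEuler, Thm 2.1–2.2 + Note added p. 6] -/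
theorem selfSimilar_ae_eq_zero_of_axisym_swirlCasimir_C2_past {ρ T T₁ : ℝ} (hρ : 0 < ρ) (hρ1 : ρ ≤ 1 / 2)
    (hT₁ : T₁ ≤ 0) (hTT₁ : T₁ ≤ T) (x₀ : EuclideanSpace ℝ (Fin 3))
    (hsw : IsSuitableWeakSolutionOn (slab (EuclideanSpace ℝ (Fin 3)) (Iio 0) isOpen_Iio) 0 0 u p)
    (hH : HasWeakSpatialGradientOn (slab (EuclideanSpace ℝ (Fin 3)) (Iio 0) isOpen_Iio) u H)
    (hgauge : ∀ a : ℝ, 0 < a →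
      ENNReal.ofReal (a ^ (2 * ρ)) * cknA a (0 : ℝ × EuclideanSpace ℝ (Fin 3)) u +
          ENNReal.ofReal (a ^ ρ) * cknE a (0 : ℝ × EuclideanSpace ℝ (Fin 3)) H +
        ENNReal.ofReal (a ^ (2 * ρ)) * cknD a (0 : ℝ × EuclideanSpace ℝ (Fin 3)) p ≤ (c : ENNReal))
    (hu : ∀ τ : ℝ, τ < T₁ → u τ = fun x => selfSimilarCollapse (1 / (2 + ρ)) T V τ (x - x₀))
    (hp : ∀ τ : ℝ, τ < T₁ → p τ = fun x => selfSimilarCollapsePressure (1 / (2 + ρ)) T P τ (x - x₀))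
    (hV : ContDiff ℝ 2 V) (hax : IsAxisymmetric V)
    (hlin : ∃ K₁ : ℝ, ∀ y, ‖V y‖ ≤ K₁ * (1 + ‖y‖))
    (hLp : ∃ q : ℝ, 0 < q ∧ q ≠ 3 / ρ ∧ ∫⁻ y, ENNReal.ofReal (|swirl V y| ^ q) < ⊤) :
    uncurry u =ᵐ[volume.restrict (Iio (0 : ℝ) ×ˢ (univ : Set (EuclideanSpace ℝ (Fin 3))))] 0 := by
  obtain ⟨K₁, hK₁⟩ := hlin
  obtain ⟨q, hq, hq3, hI⟩ := hLp
  have h2ρ : (0 : ℝ) < 2 + ρ := by linarith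
  have hγ : (0 : ℝ) < 1 / (2 + ρ) := one_div_pos.2 h2ρ
  obtain ⟨P', hprof⟩ := Past.exists_isSelfSimilarEulerProfile hρ hT₁ hTT₁ hsw.distributional hu hp hV
  have hns : HasNoSwirl V := hasNoSwirl_of_swirl_Lp_ne hprof hax hγ hK₁ hq (exponent_ne_of_ne hρ hq3) hI
  exact NeedleRace.selfSimilar_ae_eq_zero_of_axisymNoSwirlC2_past hρ hρ1 hT₁ hTT₁ x₀ hsw hH hgauge hu hp hV hax hns

end SwirlRatchet

end Summit.NavierStokesRegularity.NavierStokesRegularity.Theorems.PowerGaugeEulerLiouville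

end
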